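import Literature.Probability.LatticeModels.LoopO1
import Literature.Probability.LatticeModels.IsingThermodynamics
import Literature.Probability.LatticeModels.ModifiedSimonInequality
import HarnessLib

/-!
# Crux IndependentStrandsJoin (stmt-CriticalPhenomena-14625) — first-moment exchange for the hole mass

Route `FKParityRobustness`, sub-problem `Ising3DConformalLimit`, line `union-shadow-exact`; registered aux stub
`stub_massFirstMomentExchange`, the bookkeeping first line of the open concentration stub `stub_massConcentration`
(stub 5 of the line: `UnionAttach → BulkResponseFloor → MassPositive`).

On EVERY finite graph `G`, for every real `t`, every finite set `B` of vertices (the bulk), every weight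
`δ : V → ℝ` (the single-site deficits) and sources `a₂, a₃`, the un-normalised FIRST MOMENT of the additive mass
`X(F₂, F₀) := Σ_{u ∈ B, a₂ ↝_{F₂ ∪ F₀} u} δ u` carried by the union cluster of `a₂` under the product of the strand
configuration `F₂ ∈ 𝒯(a₂a₃)` and one vacuum configuration `F₀ ∈ 𝒯(∅)` is the `δ`-weighted sum of the un-normalised
ONE-POINT functions of that cluster:

`Σ_{F₂ ∈ 𝒯(a₂a₃)} Σ_{F₀ ∈ 𝒯(∅)} t^{|F₂|+|F₀|} · X(F₂, F₀)
   = Σ_{u ∈ B} δ u · Σ_{F₂ ∈ 𝒯(a₂a₃)} Σ_{F₀ ∈ 𝒯(∅)} 1[a₂ ↝_{F₂ ∪ F₀} u] t^{|F₂|+|F₀|}`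

(pure exchange of finite sums: `Finset.sum_filter`, `Finset.mul_sum`, `Finset.sum_comm`).  Combined with the one-point
floor `stub_unionAttach` (stub 3) and the bulk response floor `stub_bulkResponseFloor` (stub 4) it gives
`E[X(C⁺)] ≥ c₀ c₁ ⟨σ_{a₀}σ_{a₁}⟩`; the upgrade to `P[X(C⁺) ≥ ε ⟨σ_{a₀}σ_{a₁}⟩] ≥ p` (`MassPositive`) needs a
second-moment / concentration input that is not in the tree (see the stub's notes).  Theorem-only file.
-/

noncomputable section

open Finset SimpleGraph
open Literature.Probability.LatticeModels

namespace Summit.CriticalPhenomena.Ising3DConformalLimit.Theorems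

open scoped Classical BigOperators

/-- Abstract exchange of sums behind `stub_massFirstMomentExchange`: a double sum of (weight × filtered sum of
`δ`) equals the `δ`-weighted sum of the indicator-restricted double sums of the weight. -/
private theorem sum_sum_mul_sum_filter_exchange {ι κ α : Type*} (s : Finset ι) (r : Finset κ) (B : Finset α)
    (w : ι → κ → ℝ) (R : ι → κ → α → Prop) [∀ i k a, Decidable (R i k a)] (δ : α → ℝ) :
    ∑ i ∈ s, ∑ k ∈ r, w i k * ∑ a ∈ B.filter (fun a => R i k a), δ a
      = ∑ a ∈ B, δ a * ∑ i ∈ s, ∑ k ∈ r, (if R i k a then w i k else 0) := by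
  have key : ∀ i k, w i k * ∑ a ∈ B.filter (fun a => R i k a), δ a
      = ∑ a ∈ B, δ a * (if R i k a then w i k else 0) := by
    intro i k
    rw [Finset.sum_filter, Finset.mul_sum]
    refine Finset.sum_congr rfl fun a _ => ?_
    split_ifs <;> ring
  calc ∑ i ∈ s, ∑ k ∈ r, w i k * ∑ a ∈ B.filter (fun a => R i k a), δ a
      = ∑ i ∈ s, ∑ k ∈ r, ∑ a ∈ B, δ a * (if R i k a then w i k else 0) := by simp_rw [key]
    _ = ∑ i ∈ s, ∑ a ∈ B, ∑ k ∈ r, δ a * (if R i k a then w i k else 0) :=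
        Finset.sum_congr rfl fun _ _ => Finset.sum_comm
    _ = ∑ a ∈ B, ∑ i ∈ s, ∑ k ∈ r, δ a * (if R i k a then w i k else 0) := Finset.sum_comm
    _ = ∑ a ∈ B, δ a * ∑ i ∈ s, ∑ k ∈ r, (if R i k a then w i k else 0) := by
        simp_rw [Finset.mul_sum]

/-- **Registered aux stub `stub_massFirstMomentExchange`** (crux stmt-CriticalPhenomena-14625, line `union-shadow-exact`,
bookkeeping of stub 5 `stub_massConcentration`): the FIRST-MOMENT EXCHANGE for the additive mass of the union cluster.
On every finite graph, for every real `t`, bulk `B`, weights `δ` and sources `a₂, a₃`,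
`Σ_{F₂ ∈ 𝒯(a₂a₃)} Σ_{F₀ ∈ 𝒯(∅)} t^{|F₂|+|F₀|} · Σ_{u ∈ B, a₂ ↝_{F₂∪F₀} u} δ u
  = Σ_{u ∈ B} δ u · Σ_{F₂} Σ_{F₀} 1[a₂ ↝_{F₂∪F₀} u] t^{|F₂|+|F₀|}`. -/
theorem stub_massFirstMomentExchange :
    ∀ (V : Type) [Fintype V] [DecidableEq V] (G : SimpleGraph V) [DecidableRel G.Adj] (t : ℝ)
      (B : Finset V) (δ : V → ℝ) (a₂ a₃ : V),
      ∑ F₂ ∈ tJoins G Set.univ {a₂, a₃}, ∑ F₀ ∈ tJoins G Set.univ (∅ : Finset V),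
          t ^ (F₂.card + F₀.card) *
            ∑ u ∈ B.filter (fun u : V =>
              (SimpleGraph.fromEdgeSet ((↑F₂ : Set (Sym2 V)) ∪ ↑F₀)).Reachable a₂ u), δ u
        =
      ∑ u ∈ B, δ u *
        ∑ F₂ ∈ tJoins G Set.univ {a₂, a₃}, ∑ F₀ ∈ tJoins G Set.univ (∅ : Finset V),
          if (SimpleGraph.fromEdgeSet ((↑F₂ : Set (Sym2 V)) ∪ ↑F₀)).Reachable a₂ u
          then t ^ (F₂.card + F₀.card) else 0 := by
  intro V _ _ G _ t B δ a₂ a₃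
  exact sum_sum_mul_sum_filter_exchange (tJoins G Set.univ {a₂, a₃}) (tJoins G Set.univ (∅ : Finset V)) B
    (fun F₂ F₀ => t ^ (F₂.card + F₀.card))
    (fun F₂ F₀ u => (SimpleGraph.fromEdgeSet ((↑F₂ : Set (Sym2 V)) ∪ ↑F₀)).Reachable a₂ u) δ

end Summit.CriticalPhenomena.Ising3DConformalLimit.Theorems

end
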